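import Mathlib
import HarnessLib
import Literature.AlgebraicGeometry.Ramification.InertiaNormalSylow
import Literature.AlgebraicGeometry.Resolution.AugmentationIdeal
import Literature.AlgebraicGeometry.Resolution.StalkIdealLemmas
import Summits.ResolutionOfSingularities.ResolutionOfSingularities.Theorems.WildQuotientsWildQuotientResolutionStubInertiaLe
import Summits.ResolutionOfSingularities.ResolutionOfSingularities.Theorems.WildQuotientsWildQuotientResolutionStandardFormPhaseZero

/-!
# Transport of the standard-form hypothesis along equivariant morphisms: ESTABLISHMENT and PERSISTENCE
# (crux `WildQuotients.WildQuotientResolution`, stub `stub_phaseZeroHighDim`; any dimension)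

Crux stmt-ResolutionOfSingularities-15640 (`WildQuotientResolution`), registered stub `stub_phaseZeroHighDim`.
By ✓`StandardForm.phaseZero_of_standardFormModel` (p821758) the stub follows, in every dimension, from an
equivariant regular model in p-STANDARD FORM: at every point `x`, boundary equations with stable lines such that
every tame `g ≠ 1` in `I_x` has some boundary equation in `𝔞_{τ g} + 𝔪_x²` — geometrically
(✓`mem_augIdeal_of_mem_stalkIdeal_inertLocus`), some boundary divisor through `x` contains the germ at `x` of the
reduced inert locus `Z_⟨g⟩ = {y | ⟨g⟩ ≤ I_y}`. A p-standardisation procedure manufactures this hypothesis by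
blow-ups; this file proves the two facts about inert loci along an EQUIVARIANT morphism `π : X → Y`
(`σ g ≫ π = π ≫ ρ g`) on which any such procedure runs:

* ESTABLISHMENT (`mem_augIdeal_of_inertLocus_subset_centre`): if a closed `W ⊆ Y` contains the inert locus
  `Z_⟨g⟩(Y)` (e.g. `W` = the centre `Z_⟨g⟩` of the orbit tame move ✓`tameOrbitMove`, or any centre containing
  it), then at every `x ∈ X` with regular stalk and `g ∈ I_x` tame, every function vanishing on `π⁻¹ W` near
  `x` — in particular a local equation of the exceptional divisor when `π` is the blow-up of `W` — lies in
  `𝔞_{τ g}`: ONE move along a centre containing `Z_⟨g⟩` puts the inert locus of `g` inside the boundary at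
  every point upstairs;
* PERSISTENCE (`stalkMap_mem_stalkIdeal_inertLocus`, `stalkMap_mem_augIdeal`,
  `exists_mem_augIdeal_of_unit_mul_prod_mem`): functions vanishing on `Z_K(Y)` pull back to functions vanishing on
  `Z_K(X)` (inertia shrinks, ✓`InertiaLe.stub_inertia_le`: `Z_K(X) ⊆ π⁻¹ Z_K(Y)`); for tame `g` on a regular stalk
  the pull-back lands in the PRIME ideal `𝔞_{τ g}` (`isPrime_augIdeal`), so if the old boundary equation becomes
  upstairs a unit times a product of new boundary equations (normal crossings total transform), one of the new
  equations lies in `𝔞_{τ g}`: the fixed-locus hypothesis, once established for `g`, survives every later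
  equivariant blow-up whose total boundary stays a normal crossings divisor.

Consequently the EXISTENCE half of Phase 0 in standard form reduces to an ORDERING problem only through the
regularity of the centres: one orbit tame move per conjugacy class of tame cyclic subgroups suffices AS SOON AS
the `G`-translates of each `Z_⟨g⟩` are disjoint or equal when its turn comes (✓`TameOrbitCentre` p820560) and the
boundary is kept with normal crossings and strict (✓`TameFixedLocusBoundary` p817967) — the residual named
ORBIT GERMS in the evidence memos of hands 6 g2/g3 on the item.

[OURS · crux stmt-ResolutionOfSingularities-15640 · helper toward `stub_phaseZeroHighDim` (transport layer of the
standard-form route; NOT a proof of the stub); folklore scheme theory, counted 0; AI-level work, weaker than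
expert review.] [folklore]
-/

-- single-problem summit: the doubled namespace component `ResolutionOfSingularities` is forced
set_option linter.dupNamespace false

noncomputable section

open CategoryTheory AlgebraicGeometry TopologicalSpace IsLocalRing
open Literature.AlgebraicGeometry.Resolution Literature.AlgebraicGeometry.Ramification
open Scheme.IdealSheafData
open Summit.ResolutionOfSingularities.ResolutionOfSingularities.Theorems.WildQuotientResolution.PointBlowupStalkData
open Summit.ResolutionOfSingularities.ResolutionOfSingularities.Theorems.WildQuotientResolution.InertLocusStalk

namespace Summit.ResolutionOfSingularities.ResolutionOfSingularities.Theorems.WildQuotientResolution.StandardForm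

/-! ## Inert loci along an equivariant morphism -/

section Transport

variable {X Y : Scheme.{0}} {G : Type} [Group G] (σ : G →* Aut X) (ρ : G →* Aut Y)
  (π : X ⟶ Y) (hequiv : ∀ g : G, (σ g).hom ≫ π = π ≫ (ρ g).hom)

include hequiv

/-- **Inert loci upstairs lie over inert loci downstairs**: along an equivariant `π`, `Z_K(X) ⊆ π⁻¹ Z_K(Y)`
(inertia groups shrink, ✓`InertiaLe.stub_inertia_le`). [folklore] -/
theorem inertLocus_subset_preimage (K : Subgroup G) :
    {x : X | K ≤ inertiaSubgroup σ x} ⊆ π.base ⁻¹' {y : Y | K ≤ inertiaSubgroup ρ y} :=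
  fun x hx => le_trans (b := inertiaSubgroup σ x) hx (InertiaLe.stub_inertia_le σ ρ π hequiv x)

/-- The same inclusion as an inequality of closed subsets. [folklore] -/
theorem inertLocus_le_preimage (K : Subgroup G) (hZ : IsClosed {y : Y | K ≤ inertiaSubgroup ρ y})
    (hZ' : IsClosed {x : X | K ≤ inertiaSubgroup σ x}) :
    (⟨{x : X | K ≤ inertiaSubgroup σ x}, hZ'⟩ : Closeds X) ≤
      (⟨{y : Y | K ≤ inertiaSubgroup ρ y}, hZ⟩ : Closeds Y).preimage π.continuous :=
  inertLocus_subset_preimage σ ρ π hequiv K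

/-- **PULL-BACK**: a function vanishing on the inert locus `Z_K(Y)` near `π x` pulls back to a function vanishing
on `Z_K(X)` near `x` (`I(π⁻¹Z)_x = √(I(Z)_{π x} 𝒪_{X,x})`, ✓`stalkIdeal_vanishingIdeal_preimage`, and
`I(π⁻¹ Z_K(Y)) ≤ I(Z_K(X))`). [folklore] -/
theorem stalkMap_mem_stalkIdeal_inertLocus (K : Subgroup G)
    (hZ : IsClosed {y : Y | K ≤ inertiaSubgroup ρ y}) (hZ' : IsClosed {x : X | K ≤ inertiaSubgroup σ x})
    (x : X) {z : Y.presheaf.stalk (π.base x)}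
    (hz : z ∈ stalkIdeal (vanishingIdeal ⟨{y : Y | K ≤ inertiaSubgroup ρ y}, hZ⟩) (π.base x)) :
    (π.stalkMap x).hom z ∈ stalkIdeal (vanishingIdeal ⟨{x : X | K ≤ inertiaSubgroup σ x}, hZ'⟩) x := by
  have h1 : (π.stalkMap x).hom z ∈ stalkIdeal (vanishingIdeal
      ((⟨{y : Y | K ≤ inertiaSubgroup ρ y}, hZ⟩ : Closeds Y).preimage π.continuous)) x := by
    rw [stalkIdeal_vanishingIdeal_preimage]
    exact Ideal.le_radical (Ideal.mem_map_of_mem _ hz)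
  exact stalkIdeal_mono (vanishingIdeal_antimono (inertLocus_le_preimage σ ρ π hequiv K hZ hZ')) x h1

/-- **Functions vanishing on the preimage of a closed set containing the inert locus vanish on the inert locus
upstairs.** [folklore] -/
theorem mem_stalkIdeal_inertLocus_of_subset (K : Subgroup G) (W : Closeds Y)
    (hW : {y : Y | K ≤ inertiaSubgroup ρ y} ⊆ W) (hZ' : IsClosed {x : X | K ≤ inertiaSubgroup σ x})
    (x : X) {t : X.presheaf.stalk x} (ht : t ∈ stalkIdeal (vanishingIdeal (W.preimage π.continuous)) x) :
    t ∈ stalkIdeal (vanishingIdeal ⟨{x : X | K ≤ inertiaSubgroup σ x}, hZ'⟩) x := by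
  have hle : (⟨{x : X | K ≤ inertiaSubgroup σ x}, hZ'⟩ : Closeds X) ≤ W.preimage π.continuous :=
    fun x hx => hW (inertLocus_subset_preimage σ ρ π hequiv K hx)
  exact stalkIdeal_mono (vanishingIdeal_antimono hle) x ht

omit hequiv in
/-- The exceptional equation vanishes on the preimage of the centre: if the ideal sheaf `J` cuts out (at least)
the closed set `W` (`J ≤ I(W)`), every element of `(π⁻¹J · 𝒪_X)_x` vanishes on `π⁻¹ W` near `x`. [folklore] -/
theorem mem_stalkIdeal_vanishingIdeal_preimage_of_le {J : Y.IdealSheafData} (W : Closeds Y)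
    (hJ : J ≤ vanishingIdeal W) (x : X) {t : X.presheaf.stalk x} (ht : t ∈ stalkIdeal (J.comap π) x) :
    t ∈ stalkIdeal (vanishingIdeal (W.preimage π.continuous)) x := by
  rw [vanishingIdeal_preimage]
  exact stalkIdeal_mono ((comap_mono (f := π) hJ).trans (le_radical (I := (vanishingIdeal W).comap π))) x ht

end Transport

/-! ## Tame elements on regular stalks: primality, establishment, persistence -/

section Tame

variable {X Y : Scheme.{0}} {G : Type} [Group G] [Finite G] (σ : G →* Aut X) (ρ : G →* Aut Y)
  (π : X ⟶ Y) (hequiv : ∀ g : G, (σ g).hom ≫ π = π ≫ (ρ g).hom)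
  (p : ℕ) [Fact p.Prime] (x : X) [IsRegularLocalRing (X.presheaf.stalk x)]
  [CharP (ResidueField (X.presheaf.stalk x)) p]
  {I : Subgroup G} (a : I → (X.presheaf.stalk x ⟶ X.presheaf.stalk x))
  (τ : I →* (X.presheaf.stalk x ≃+* X.presheaf.stalk x))
  (hkey : ∀ g : I, Spec.map (a g) ≫ X.fromSpecStalk x = X.fromSpecStalk x ≫ (σ (g : G)).hom)
  (hτ : ∀ (g : I) (r : X.presheaf.stalk x), τ g r = (a g⁻¹).hom r)

include hkey hτ

/-- **The augmentation ideal of a tame element of the inertia group of a regular point is prime**: for a stalk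
action `(a, τ)` of `I` at `x`, `𝒪_{X,x}` regular of residue characteristic `p`, and `g ∈ I ∩ I_x` of order
prime to `p`, `𝔞_{τ g}` is the fixed-locus ideal of `⟨g⟩`, whose quotient is a regular local ring
(✓`TameFixedLocus.isRegularLocalRing_quotient_iSup_augIdeal`), hence a domain. [folklore] -/
theorem isPrime_augIdeal (g : I) (hg : (orderOf g).Coprime p) (hgx : (g : G) ∈ inertiaSubgroup σ x) :
    (augIdeal (τ g)).IsPrime := by
  have hK : Subgroup.zpowers (g : G) ≤ I := (Subgroup.zpowers_le).mpr g.2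
  have hKx : Subgroup.zpowers (g : G) ≤ inertiaSubgroup σ x := (Subgroup.zpowers_le).mpr hgx
  have hKu : IsUnit ((Nat.card (Subgroup.zpowers (g : G)) : ℕ) : X.presheaf.stalk x) := by
    rw [Nat.card_zpowers, Subgroup.orderOf_coe]
    exact TameFixedLocus.isUnit_natCast_of_not_dvd p
      ((Nat.Prime.coprime_iff_not_dvd (Fact.out : p.Prime)).mp hg.symm)
  have hm : (⨆ k : Subgroup.zpowers (g : G), augIdeal ((τ.comp (Subgroup.inclusion hK)) k)) ≤
      maximalIdeal (X.presheaf.stalk x) :=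
    (mem_inertLocus_iff_iSup_augIdeal_le σ x a τ hkey hτ hK).mp hKx
  have heq : (⨆ k : Subgroup.zpowers (g : G), augIdeal ((τ.comp (Subgroup.inclusion hK)) k)) =
      augIdeal (τ g) := by
    refine le_antisymm (iSup_augIdeal_zpowers_le x τ g hK) ?_
    have hgK : (g : G) ∈ Subgroup.zpowers (g : G) := Subgroup.mem_zpowers _
    have h1 : (τ.comp (Subgroup.inclusion hK)) ⟨(g : G), hgK⟩ = τ g := by
      rw [MonoidHom.comp_apply]
      congr 1
    calc augIdeal (τ g) = augIdeal ((τ.comp (Subgroup.inclusion hK)) ⟨(g : G), hgK⟩) := by rw [h1]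
      _ ≤ ⨆ k : Subgroup.zpowers (g : G), augIdeal ((τ.comp (Subgroup.inclusion hK)) k) :=
        le_iSup (fun k : Subgroup.zpowers (g : G) => augIdeal ((τ.comp (Subgroup.inclusion hK)) k))
          ⟨(g : G), hgK⟩
  haveI hreg := TameFixedLocus.isRegularLocalRing_quotient_iSup_augIdeal (τ.comp (Subgroup.inclusion hK))
    hKu hm
  haveI : IsDomain (X.presheaf.stalk x ⧸
      ⨆ k : Subgroup.zpowers (g : G), augIdeal ((τ.comp (Subgroup.inclusion hK)) k)) :=
    isDomain_of_isRegularLocalRing _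
  rw [← heq]
  exact (Ideal.Quotient.isDomain_iff_prime _).mp this

/-- **Normal crossings total transform**: if a unit multiple of a product `∏ tᵢ` lies in `𝔞_{τ g}` (`g` tame in
`I_x`, regular stalk), some `tᵢ` lies in `𝔞_{τ g}` — the germ of the regular inert locus `Z_⟨g⟩` inside a normal
crossings divisor lies in one of its branches. [folklore] -/
theorem exists_mem_augIdeal_of_unit_mul_prod_mem (g : I) (hg : (orderOf g).Coprime p)
    (hgx : (g : G) ∈ inertiaSubgroup σ x) {ι : Type*} (s : Finset ι) (t : ι → X.presheaf.stalk x)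
    {u : X.presheaf.stalk x} (hu : IsUnit u) (h : u * ∏ i ∈ s, t i ∈ augIdeal (τ g)) :
    ∃ i ∈ s, t i ∈ augIdeal (τ g) := by
  haveI := isPrime_augIdeal σ p x a τ hkey hτ g hg hgx
  exact Ideal.IsPrime.prod_mem_iff.mp ((Ideal.unit_mul_mem_iff_mem _ hu).mp h)

include hequiv

/-- **PERSISTENCE**: along an equivariant `π : X → Y`, a function vanishing on the inert locus `Z_⟨g⟩(Y)` near
`π x` pulls back into `𝔞_{τ g}` at `x` (`g ∈ I_x` tame, `𝒪_{X,x}` regular): the boundary divisor that contained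
the inert locus of `g` downstairs still contains it upstairs, through its total transform. [folklore] -/
theorem stalkMap_mem_augIdeal (g : I) (hg : (orderOf g).Coprime p) (hgx : (g : G) ∈ inertiaSubgroup σ x)
    (hZ : IsClosed {y : Y | Subgroup.zpowers (g : G) ≤ inertiaSubgroup ρ y})
    (hZ' : IsClosed {x' : X | Subgroup.zpowers (g : G) ≤ inertiaSubgroup σ x'})
    {z : Y.presheaf.stalk (π.base x)}
    (hz : z ∈ stalkIdeal (vanishingIdeal
      ⟨{y : Y | Subgroup.zpowers (g : G) ≤ inertiaSubgroup ρ y}, hZ⟩) (π.base x)) :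
    (π.stalkMap x).hom z ∈ augIdeal (τ g) :=
  mem_augIdeal_of_mem_stalkIdeal_inertLocus σ p x a τ hkey hτ g hg hgx hZ'
    (stalkMap_mem_stalkIdeal_inertLocus σ ρ π hequiv _ hZ hZ' x hz)

/-- **PERSISTENCE, normal crossings form**: if moreover the pulled-back boundary equation is a unit times a
product of the new boundary equations `tᵢ` at `x` (normal crossings total transform), one of the `tᵢ` lies in
`𝔞_{τ g}`. [folklore] -/
theorem exists_mem_augIdeal_of_stalkMap_eq (g : I) (hg : (orderOf g).Coprime p)
    (hgx : (g : G) ∈ inertiaSubgroup σ x)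
    (hZ : IsClosed {y : Y | Subgroup.zpowers (g : G) ≤ inertiaSubgroup ρ y})
    (hZ' : IsClosed {x' : X | Subgroup.zpowers (g : G) ≤ inertiaSubgroup σ x'})
    {z : Y.presheaf.stalk (π.base x)}
    (hz : z ∈ stalkIdeal (vanishingIdeal
      ⟨{y : Y | Subgroup.zpowers (g : G) ≤ inertiaSubgroup ρ y}, hZ⟩) (π.base x))
    {ι : Type*} (s : Finset ι) (t : ι → X.presheaf.stalk x) {u : X.presheaf.stalk x} (hu : IsUnit u)
    (ht : (π.stalkMap x).hom z = u * ∏ i ∈ s, t i) :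
    ∃ i ∈ s, t i ∈ augIdeal (τ g) :=
  exists_mem_augIdeal_of_unit_mul_prod_mem σ p x a τ hkey hτ g hg hgx s t hu
    (ht ▸ stalkMap_mem_augIdeal σ ρ π hequiv p x a τ hkey hτ g hg hgx hZ hZ' hz)

/-- **ESTABLISHMENT**: along an equivariant `π : X → Y`, if the closed `W ⊆ Y` contains the inert locus
`Z_⟨g⟩(Y)`, then every function vanishing on `π⁻¹ W` near `x` lies in `𝔞_{τ g}` (`g ∈ I_x` tame, `𝒪_{X,x}`
regular). For `π` the blow-up of a regular centre `W ⊇ Z_⟨g⟩` and `t` a local equation of the exceptional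
divisor at `x` (`mem_stalkIdeal_vanishingIdeal_preimage_of_le`), this says: the inert locus of `g` upstairs lies
in the exceptional divisor — the fixed-locus hypothesis of ✓`hasNormalSylow_inertia_of_standardForm` for `g`
holds at every point above with `t` as boundary equation. [folklore] -/
theorem mem_augIdeal_of_inertLocus_subset_centre (g : I) (hg : (orderOf g).Coprime p)
    (hgx : (g : G) ∈ inertiaSubgroup σ x) (W : Closeds Y)
    (hW : {y : Y | Subgroup.zpowers (g : G) ≤ inertiaSubgroup ρ y} ⊆ W)
    (hZ' : IsClosed {x' : X | Subgroup.zpowers (g : G) ≤ inertiaSubgroup σ x'})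
    {t : X.presheaf.stalk x} (ht : t ∈ stalkIdeal (vanishingIdeal (W.preimage π.continuous)) x) :
    t ∈ augIdeal (τ g) :=
  mem_augIdeal_of_mem_stalkIdeal_inertLocus σ p x a τ hkey hτ g hg hgx hZ'
    (mem_stalkIdeal_inertLocus_of_subset σ ρ π hequiv _ W hW hZ' x ht)

/-- **ESTABLISHMENT for a blow-up-type morphism**: with `J ≤ I(W)` an ideal sheaf on `Y` cutting out at least
`W ⊇ Z_⟨g⟩(Y)`, every element of `(π⁻¹J · 𝒪_X)_x` — e.g. the local equation of the exceptional divisor of the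
blow-up of `J` — lies in `𝔞_{τ g}`. [folklore] -/
theorem mem_augIdeal_of_mem_stalkIdeal_comap (g : I) (hg : (orderOf g).Coprime p)
    (hgx : (g : G) ∈ inertiaSubgroup σ x) {J : Y.IdealSheafData} (W : Closeds Y)
    (hJ : J ≤ vanishingIdeal W) (hW : {y : Y | Subgroup.zpowers (g : G) ≤ inertiaSubgroup ρ y} ⊆ W)
    (hZ' : IsClosed {x' : X | Subgroup.zpowers (g : G) ≤ inertiaSubgroup σ x'})
    {t : X.presheaf.stalk x} (ht : t ∈ stalkIdeal (J.comap π) x) :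
    t ∈ augIdeal (τ g) :=
  mem_augIdeal_of_inertLocus_subset_centre σ ρ π hequiv p x a τ hkey hτ g hg hgx W hW hZ'
    (mem_stalkIdeal_vanishingIdeal_preimage_of_le π W hJ x ht)

end Tame

end Summit.ResolutionOfSingularities.ResolutionOfSingularities.Theorems.WildQuotientResolution.StandardForm

end
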